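import Literature.Geometry.Lorentzian.KerrCylinderDatum
import Literature.Geometry.Lorentzian.InteriorKerrGluingProofs
import Literature.Geometry.Lorentzian.KerrConvergenceProofs
import Literature.Analysis.Calculus.ParametricIteratedFDeriv
import HarnessLib

/-!
# The Kerr-cylinder metric is `C^k`-close to the Schwarzschild cylinder: `O(|m − M| + |a|)`

Support file (all results proved; no named facts) for the named fact `LiMei.interiorKerrGluing`
(`InteriorKerrGluing.lean`; J. Li, H. Mei, *A construction of collapsing spacetimes in vacuum*,
Comm. Math. Phys. 378 (2020) = arXiv:2005.01249, Prop. 4.1). In the first step of the printed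
proof (p. 22) the Kerr cylinder data `(ḡ_{m,a⃗}, π̄_{m,a⃗})` on `{r = r₀}` enter through the
estimate "`‖(ḡ_{m,a⃗} − ḡ_{m₀}, π̄_{m,a⃗} − π̄_{m₀})‖_{C^k} ≤ C(|m − m₀| + |a⃗|)`" (with (4.2),
`ḡ_{m,a} = ḡ_m + O(a)`), which makes the glued datum `Cε`-close to the Schwarzschild cylinder when
`|m − m₀| + |a⃗| ≤ C₀ε`. This file proves the METRIC half of that estimate for the tree's explicit
Kerr-cylinder datum (`LiMei.kerrCylinderDatum`, metric field `cylH`; `KerrCylinderDatum.lean`),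
uniformly in the axis rotation `R`:

* `Kerr.contDiffAt_bilin₃` — the Kerr–Schild metric `(m, a, x) ↦ g_{m,a}(x)` is jointly smooth on
  `{r > 0}` (`g_{m,a} = η + m (g_{1,a} − η)` and the tree's joint smoothness in `(a, x)`,
  `Kerr.contDiffAt_ksPert₂`);
* `contDiffAt_kerrCylMap₂`, `contDiffAt_kerrCylDeriv₂`, `contDiffOn_cylH₀₃` — the cylinder map, its
  differential and the pulled-back metric `H₀ = ψ^*g_{m,a}` are jointly smooth in `(a, y)`, resp.
  `(m, a, y)`, off the origin;
* `cylH₀_zero_spin` — at `(m, a) = (M, 0)` the pulled-back metric IS the Schwarzschild cylinder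
  metric `ḡ_M` of Li–Mei (4.1) (`gbarRep`), for every rotation `R`;
* `cylH₀_isometry` — rotations act by precomposition (`H₀[R](y)(v, w) = H₀[id](Ry)(Rv, Rw)`);
* `exists_norm_iteratedFDeriv_cylH_sub_gbarRep_le` — **the estimate**: for `0 < r₀`, `1 ≤ ρ₁` and
  every `k` there is `C` such that for `|m − M| + |a| ≤ 1`, every rotation `R`, unit `v, w`,
  `i ≤ k` and `ρ₁ < ‖y‖ < ρ₂`,
  `‖Dⁱ[z ↦ h_{m,a,R}(z)(v, w) − ḡ_M(z)(v, w)](y)‖ ≤ C (|m − M| + |a|)`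
  (joint smoothness + the mean value inequality in the parameters,
  `Literature.Analysis.Calculus.exists_norm_iteratedFDeriv_le_parametric_of_eq_zero`), and its
  reading for the datum, `exists_norm_iteratedFDeriv_kerrCylinderDatum_h_sub_le` (the `h`-half of
  `NearSchwarzschildCylinder M r₁ r₀ ρ₁ ρ₂ k (C(|m − M| + |a|)) (kerrCylinderDatum …)`).

The `k`-half (second fundamental form) needs the joint smoothness in `(m, a)` of the chart
expression of `K_ν(ψ)` and is not in this file.

## References

* J. Li, H. Mei, *A construction of collapsing spacetimes in vacuum*, Comm. Math. Phys. 378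
  (2020), arXiv:2005.01249, §4, (4.1)–(4.2) and proof of Prop. 4.1, p. 22 (key `LiMei2020`).
* R. P. Kerr, A. Schild (1965), §3; M. Visser, arXiv:0706.0622, (32)–(35) (key `KerrSchild1965`).
-/

noncomputable section

open Bundle Set TopologicalSpace Manifold Module Filter Function Metric
open scoped Manifold ContDiff Topology RealInnerProductSpace

namespace Literature.Geometry.Lorentzian

/-! ### Shortcut instances

Typeclass synthesis on the normed spaces of bilinear forms `E →L[ℝ] E →L[ℝ] ℝ` is slow in this
file's import closure; these local shortcuts are the canonical instances. -/

/-- Shortcut: the space of bilinear forms on `E3` is a normed group (canonical instance). -/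
local instance instNormedAddCommGroupBilinE3 : NormedAddCommGroup (E3 →L[ℝ] E3 →L[ℝ] ℝ) :=
  ContinuousLinearMap.toNormedAddCommGroup

/-- Shortcut: the space of bilinear forms on `E3` is a normed space (canonical instance). -/
local instance instNormedSpaceBilinE3 : NormedSpace ℝ (E3 →L[ℝ] E3 →L[ℝ] ℝ) :=
  ContinuousLinearMap.toNormedSpace

/-- Shortcut: the space of bilinear forms on `E4` is a normed group (canonical instance). -/
local instance instNormedAddCommGroupBilinE4 : NormedAddCommGroup (E4 →L[ℝ] E4 →L[ℝ] ℝ) :=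
  ContinuousLinearMap.toNormedAddCommGroup

/-- Shortcut: the space of bilinear forms on `E4` is a normed space (canonical instance). -/
local instance instNormedSpaceBilinE4 : NormedSpace ℝ (E4 →L[ℝ] E4 →L[ℝ] ℝ) :=
  ContinuousLinearMap.toNormedSpace

/-! ### Joint smoothness of the Kerr–Schild metric in `(m, a, x)` -/

namespace Kerr

/-- `g_{M,a} = η + M (g_{1,a} − η)`: the Kerr–Schild perturbation is linear in the mass
(`H = M r³/(r⁴ + a²z²)`). Kerr–Schild 1965, §2; Visser arXiv:0706.0622, (32)–(33).
[cite: KerrSchild1965, §2] -/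
theorem bilin_eq_minkowski_add_smul (M a : ℝ) (x : E4) :
    bilin M a x = Minkowski.bilin + M • (bilin 1 a x - Minkowski.bilin) := by
  rw [ksPert_eq, smul_smul]
  have hH : 2 * scalarH M a x = M * (2 * scalarH 1 a x) := by
    unfold scalarH
    ring
  show Minkowski.bilin + (2 * scalarH M a x) • E4.tmul (nullCovector a x) (nullCovector a x) = _
  rw [hH]

/-- **The Kerr–Schild metric `(m, a, x) ↦ g_{m,a}(x)` is jointly `C^n` wherever `r > 0`.**
Kerr–Schild 1965, §3; Visser arXiv:0706.0622, (32)–(35). [cite: KerrSchild1965, §3] -/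
theorem contDiffAt_bilin₃ {q : ℝ × ℝ × E4} (hq : 0 < radius q.2.1 q.2.2) {n : ℕ∞ω} :
    ContDiffAt ℝ n (fun q : ℝ × ℝ × E4 ↦ bilin q.1 q.2.1 q.2.2) q := by
  have e : (fun q : ℝ × ℝ × E4 ↦ bilin q.1 q.2.1 q.2.2) =
      fun q ↦ Minkowski.bilin + q.1 • (bilin 1 q.2.1 q.2.2 - Minkowski.bilin) :=
    funext fun q ↦ bilin_eq_minkowski_add_smul _ _ _
  rw [e]
  have hks : ContDiffAt ℝ n (fun q : ℝ × ℝ × E4 ↦ bilin 1 q.2.1 q.2.2 - Minkowski.bilin) q :=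
    (contDiffAt_ksPert₂ (p := q.2) hq).comp q contDiffAt_snd
  exact contDiffAt_const.add (contDiffAt_fst.smul hks)

end Kerr

namespace LiMei

/-! ### Joint smoothness of the cylinder map in `(a, y)` -/

/-- The ellipsoid matrix `a ↦ diag(√(r₀² + a²), √(r₀² + a²), r₀)` is smooth (`r₀ ≠ 0`).
[folklore] -/
theorem contDiff_ellipsoidCLM {r₀ : ℝ} (hr₀ : r₀ ≠ 0) {n : ℕ∞ω} :
    ContDiff ℝ n (fun a : ℝ ↦ ellipsoidCLM r₀ a) := by
  refine contDiff_clm_apply_iff.mpr fun v ↦ contDiff_euclidean.mpr fun i ↦ ?_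
  have hs : ContDiff ℝ n (fun a : ℝ ↦ Real.sqrt (r₀ ^ 2 + a ^ 2)) :=
    (contDiff_const.add (contDiff_id.pow 2)).sqrt fun a ↦ by positivity
  fin_cases i
  · simp only [ellipsoidCLM_apply, ellipsoidPt, Fin.zero_eta, Fin.isValue, PiLp.toLp_apply,
      Matrix.cons_val_zero]
    exact hs.mul contDiff_const
  · simp only [ellipsoidCLM_apply, ellipsoidPt, Fin.mk_one, Fin.isValue, PiLp.toLp_apply,
      Matrix.cons_val_one, Matrix.cons_val_zero]
    exact hs.mul contDiff_const
  · simp only [ellipsoidCLM_apply, ellipsoidPt, Fin.reduceFinMk, Fin.isValue, PiLp.toLp_apply,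
      Matrix.cons_val]
    exact contDiff_const

/-- **The Kerr cylinder map `(a, y) ↦ kerrCylMap r₀ a τ₀ R y` is jointly `C^n` off the origin**
(`r₀ ≠ 0`). [folklore] -/
theorem contDiffAt_kerrCylMap₂ {r₀ : ℝ} (hr₀ : r₀ ≠ 0) (τ₀ : ℝ) (R : E3 →ₗᵢ[ℝ] E3) {q : ℝ × E3}
    (hq : q.2 ≠ 0) {n : ℕ∞ω} :
    ContDiffAt ℝ n (fun q : ℝ × E3 ↦ kerrCylMap r₀ q.1 τ₀ R q.2) q := by
  have e : (fun q : ℝ × E3 ↦ kerrCylMap r₀ q.1 τ₀ R q.2) = fun q ↦ (‖q.2‖ + τ₀) • E4.basisVector 0 +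
      E4.spaceEmbed (ellipsoidCLM r₀ q.1 (R.toContinuousLinearMap (‖q.2‖⁻¹ • q.2))) :=
    funext fun q ↦ kerrCylMap_eq r₀ q.1 τ₀ R q.2
  rw [e]
  have hn : ContDiffAt ℝ n (fun q : ℝ × E3 ↦ ‖q.2‖) q := (contDiffAt_norm ℝ hq).comp q contDiffAt_snd
  have h1 : ContDiffAt ℝ n (fun q : ℝ × E3 ↦ (‖q.2‖ + τ₀) • E4.basisVector 0) q :=
    (hn.add contDiffAt_const).smul contDiffAt_const
  have hu : ContDiffAt ℝ n (fun q : ℝ × E3 ↦ R.toContinuousLinearMap (‖q.2‖⁻¹ • q.2)) q :=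
    R.toContinuousLinearMap.contDiff.contDiffAt.comp q
      ((hn.inv (norm_ne_zero_iff.2 hq)).smul contDiffAt_snd)
  have hE : ContDiffAt ℝ n (fun q : ℝ × E3 ↦ ellipsoidCLM r₀ q.1) q :=
    (contDiff_ellipsoidCLM hr₀).contDiffAt.comp q contDiffAt_fst
  exact h1.add (E4.spaceEmbed.contDiff.contDiffAt.comp q (hE.clm_apply hu))

/-- **The differential `(a, y) ↦ kerrCylDeriv r₀ a R y` is jointly `C^n` off the origin** (it is
the parametric derivative of the cylinder map, `ContDiffAt.fderiv`). [folklore] -/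
theorem contDiffAt_kerrCylDeriv₂ {r₀ : ℝ} (hr₀ : r₀ ≠ 0) (τ₀ : ℝ) (R : E3 →ₗᵢ[ℝ] E3) {q : ℝ × E3}
    (hq : q.2 ≠ 0) {n : ℕ∞ω} :
    ContDiffAt ℝ n (fun q : ℝ × E3 ↦ kerrCylDeriv r₀ q.1 R q.2) q := by
  have hunc : ContDiffAt ℝ (n + 1)
      (uncurry fun (q : ℝ × E3) (z : E3) ↦ kerrCylMap r₀ q.1 τ₀ R z) (q, q.2) := by
    have e : uncurry (fun (q : ℝ × E3) (z : E3) ↦ kerrCylMap r₀ q.1 τ₀ R z) =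
        (fun r : ℝ × E3 ↦ kerrCylMap r₀ r.1 τ₀ R r.2) ∘ fun r : (ℝ × E3) × E3 ↦ (r.1.1, r.2) := rfl
    rw [e]
    exact (contDiffAt_kerrCylMap₂ hr₀ τ₀ R (q := (q.1, q.2)) hq).comp (q, q.2)
      ((contDiff_fst.comp contDiff_fst).prodMk contDiff_snd).contDiffAt
  have hD : ContDiffAt ℝ n (fun q : ℝ × E3 ↦ fderiv ℝ (fun z ↦ kerrCylMap r₀ q.1 τ₀ R z) q.2) q :=
    hunc.fderiv contDiffAt_snd le_rfl
  refine hD.congr_of_eventuallyEq ?_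
  have hev : ∀ᶠ r : ℝ × E3 in 𝓝 q, r.2 ≠ 0 := (isOpen_ne.preimage continuous_snd).mem_nhds hq
  filter_upwards [hev] with r hr
  exact (fderiv_kerrCylMap r₀ r.1 τ₀ R hr).symm

/-- **The pulled-back metric `(m, a, y) ↦ H₀ = ψ^* g_{m,a}` is jointly smooth off the origin**
(`0 < r₀`): components `g_{m,a}(ψ_a y)(dψ_a v, dψ_a w)` with all three ingredients jointly smooth.
[cite: LiMei2020, Prop. 4.1] -/
theorem contDiffOn_cylH₀₃ {r₀ : ℝ} (hr₀ : 0 < r₀) (τ₀ : ℝ) (R : E3 →ₗᵢ[ℝ] E3) :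
    ContDiffOn ℝ ∞ (fun q : ℝ × ℝ × E3 ↦ cylH₀ q.1 q.2.1 r₀ τ₀ R q.2.2)
      {q : ℝ × ℝ × E3 | q.2.2 ≠ 0} := by
  refine contDiffOn_clm_apply.mpr fun v ↦ contDiffOn_clm_apply.mpr fun w ↦ fun q hq ↦ ?_
  have hq' : q.2.2 ≠ 0 := hq
  have hx : 0 < Kerr.radius q.2.1 (kerrCylMap r₀ q.2.1 τ₀ R q.2.2) := by
    rw [radius_kerrCylMap hr₀.le q.2.1 τ₀ R hq']
    exact hr₀
  have hM : ContDiffAt ℝ ∞ (fun q : ℝ × ℝ × E3 ↦ kerrCylMap r₀ q.2.1 τ₀ R q.2.2) q :=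
    (contDiffAt_kerrCylMap₂ hr₀.ne' τ₀ R (q := q.2) hq').comp q contDiffAt_snd
  have hB : ContDiffAt ℝ ∞
      (fun q : ℝ × ℝ × E3 ↦ Kerr.bilin q.1 q.2.1 (kerrCylMap r₀ q.2.1 τ₀ R q.2.2)) q := by
    have hg := Kerr.contDiffAt_bilin₃ (n := ∞) (q := (q.1, q.2.1, kerrCylMap r₀ q.2.1 τ₀ R q.2.2)) hx
    have hf : ContDiffAt ℝ ∞ (fun q : ℝ × ℝ × E3 ↦ (q.1, q.2.1, kerrCylMap r₀ q.2.1 τ₀ R q.2.2)) q :=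
      contDiffAt_fst.prodMk (contDiffAt_snd.fst.prodMk hM)
    have h := hg.comp q hf
    exact h
  have hD : ContDiffAt ℝ ∞ (fun q : ℝ × ℝ × E3 ↦ kerrCylDeriv r₀ q.2.1 R q.2.2) q :=
    (contDiffAt_kerrCylDeriv₂ hr₀.ne' τ₀ R (q := q.2) hq').comp q contDiffAt_snd
  exact ((hB.clm_apply (hD.clm_apply contDiffAt_const)).clm_apply
    (hD.clm_apply contDiffAt_const)).contDiffWithinAt

/-! ### Zero spin and rotations -/

/-- At zero spin the differential of the cylinder map is that of the rotated Schwarzschild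
cylinder map: `kerrCylDeriv r₀ 0 R y = schwCylDeriv r₀ (R y) ∘ R`. [folklore] -/
theorem kerrCylDeriv_zero_spin {r₀ : ℝ} (hr₀ : 0 ≤ r₀) (R : E3 →ₗᵢ[ℝ] E3) {y : E3} (hy : y ≠ 0) :
    kerrCylDeriv r₀ 0 R y = (schwCylDeriv r₀ (R y)).comp R.toContinuousLinearMap := by
  have h2 := hasFDerivAt_schwCylMap_comp r₀ 0 R hy
  rw [show (fun z : E3 ↦ schwCylMap r₀ 0 (R z)) = kerrCylMap r₀ 0 0 R from
    funext fun z ↦ (kerrCylMap_zero_spin hr₀ 0 R z).symm] at h2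
  exact (hasFDerivAt_kerrCylMap r₀ 0 0 R hy).unique h2

/-- Rotations preserve nonzero vectors. [folklore] -/
theorem isometry_apply_ne_zero (R : E3 →ₗᵢ[ℝ] E3) {y : E3} (hy : y ≠ 0) : R y ≠ 0 := fun h ↦
  hy (by rwa [← norm_eq_zero, LinearIsometry.norm_map, norm_eq_zero] at h)

/-- **At `(m, a) = (M, 0)` the pulled-back metric is the Schwarzschild cylinder metric `ḡ_M` of
Li–Mei (4.1)**, for every rotation `R`: `H₀[M, 0, R](y)(v, w) = gbarRep M r₀ y v w` (`y ≠ 0`).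
[cite: LiMei2020, (4.1)] -/
theorem cylH₀_zero_spin (M : ℝ) {r₀ : ℝ} (hr₀ : 0 < r₀) (τ₀ : ℝ) (R : E3 →ₗᵢ[ℝ] E3) {y : E3}
    (hy : y ≠ 0) (v w : E3) : cylH₀ M 0 r₀ τ₀ R y v w = gbarRep M r₀ y v w := by
  rw [cylH₀_apply, kerrCylDeriv_zero_spin hr₀.le R hy, kerrCylMap_zero_spin hr₀.le τ₀ R y]
  simp only [ContinuousLinearMap.comp_apply, LinearIsometry.coe_toContinuousLinearMap]
  rw [bilin_schwCylDeriv M hr₀ τ₀ (isometry_apply_ne_zero R hy) (R v) (R w), gbarRep_isometry]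

/-- Rotations act on the cylinder map by precomposition: `ψ[R](y) = ψ[id](R y)`. [folklore] -/
theorem kerrCylMap_isometry (r₀ a τ₀ : ℝ) (R : E3 →ₗᵢ[ℝ] E3) (y : E3) :
    kerrCylMap r₀ a τ₀ R y = kerrCylMap r₀ a τ₀ LinearIsometry.id (R y) := by
  simp only [kerrCylMap, LinearIsometry.norm_map, LinearIsometry.id_apply, map_smul]

/-- Rotations act on the differential by precomposition: `dψ[R]_y v = dψ[id]_{Ry} (Rv)`.
[folklore] -/
theorem kerrCylDeriv_isometry (r₀ a : ℝ) (R : E3 →ₗᵢ[ℝ] E3) (y v : E3) :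
    kerrCylDeriv r₀ a R y v = kerrCylDeriv r₀ a LinearIsometry.id (R y) (R v) := by
  simp only [kerrCylDeriv_apply, LinearIsometry.inner_map_map, LinearIsometry.norm_map, map_add,
    map_smul, LinearIsometry.id_apply]

/-- **Rotations act on the pulled-back metric by precomposition**:
`H₀[m, a, R](y)(v, w) = H₀[m, a, id](Ry)(Rv, Rw)`. [folklore] -/
theorem cylH₀_isometry (m a r₀ τ₀ : ℝ) (R : E3 →ₗᵢ[ℝ] E3) (y v w : E3) :
    cylH₀ m a r₀ τ₀ R y v w = cylH₀ m a r₀ τ₀ LinearIsometry.id (R y) (R v) (R w) := by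
  rw [cylH₀_apply, cylH₀_apply, kerrCylMap_isometry, kerrCylDeriv_isometry r₀ a R y v,
    kerrCylDeriv_isometry r₀ a R y w]

/-! ### The estimate -/

/-- Evaluation of a bilinear form at `(v, w)` as a continuous linear functional on the space of
forms. [folklore] -/
def evalBilin (v w : E3) : (E3 →L[ℝ] E3 →L[ℝ] ℝ) →L[ℝ] ℝ :=
  (ContinuousLinearMap.apply ℝ ℝ w).comp (ContinuousLinearMap.apply ℝ (E3 →L[ℝ] ℝ) v)

/-- `evalBilin v w T = T v w`. [folklore] -/
@[simp]
theorem evalBilin_apply (v w : E3) (T : E3 →L[ℝ] E3 →L[ℝ] ℝ) : evalBilin v w T = T v w := rfl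

/-- `‖evalBilin v w‖ ≤ ‖v‖ ‖w‖`. [folklore] -/
theorem norm_evalBilin_le (v w : E3) : ‖evalBilin v w‖ ≤ ‖v‖ * ‖w‖ :=
  ContinuousLinearMap.opNorm_le_bound _ (mul_nonneg (norm_nonneg _) (norm_nonneg _)) fun T ↦ by
    rw [evalBilin_apply]
    calc ‖T v w‖ ≤ ‖T v‖ * ‖w‖ := (T v).le_opNorm w
      _ ≤ ‖T‖ * ‖v‖ * ‖w‖ := mul_le_mul_of_nonneg_right (T.le_opNorm v) (norm_nonneg _)
      _ = ‖v‖ * ‖w‖ * ‖T‖ := by ring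

/-- A linear isometry of `E3` as a linear isometric equivalence. [folklore] -/
def isometryEquiv (R : E3 →ₗᵢ[ℝ] E3) : E3 ≃ₗᵢ[ℝ] E3 := R.toLinearIsometryEquiv rfl

/-- `isometryEquiv R = R` as maps. [folklore] -/
@[simp]
theorem coe_isometryEquiv (R : E3 →ₗᵢ[ℝ] E3) : ⇑(isometryEquiv R) = R := rfl

/-- **The Kerr-cylinder metric is `C^k`-close to the Schwarzschild cylinder metric, linearly in
`|m − M| + |a|`, uniformly in the rotation** (the metric half of Li–Mei's
"`‖(ḡ_{m,a⃗} − ḡ_{m₀}, π̄_{m,a⃗} − π̄_{m₀})‖_{C^k} ≤ C(|m − m₀| + |a⃗|)`", p. 22, with (4.2)): for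
`0 < r₀`, `1 ≤ ρ₁`, `ρ₂`, `τ₀` and `k` there is `C ≥ 0` such that for all `(m, a)` with
`|m − M| + |a| ≤ 1`, every linear isometry `R`, all `v, w` of norm `≤ 1`, all `i ≤ k` and all `y`
with `ρ₁ < ‖y‖ < ρ₂`,
`‖Dⁱ[z ↦ cylH m a r₀ τ₀ R z v w − gbarRep M r₀ z v w](y)‖ ≤ C (|m − M| + |a|)`.
Proof: on `{‖z‖ > 1}` the function is `(F(m, a)(Rz))(Rv, Rw)` with
`F(m, a)(y) = H₀[m, a, id](y) − H₀[M, 0, id](y)` jointly smooth in `(m, a, y)` off the origin and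
`F(M, 0) = 0` (`cylH₀_zero_spin`, `cylH₀_isometry`); the parametric mean value bound
(`exists_norm_iteratedFDeriv_le_parametric_of_eq_zero`) on the compact box `× {ρ₁ ≤ ‖y‖ ≤ ρ₂}`,
invariance of `‖Dⁱ‖` under the isometry `R` and `‖T ↦ T(v, w)‖ ≤ 1` conclude.
[cite: LiMei2020, proof of Prop. 4.1, p. 22] -/
theorem exists_norm_iteratedFDeriv_cylH_sub_gbarRep_le (M : ℝ) {r₀ : ℝ} (hr₀ : 0 < r₀) {ρ₁ : ℝ}
    (hρ₁ : 1 ≤ ρ₁) (ρ₂ τ₀ : ℝ) (k : ℕ) :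
    ∃ C : ℝ, 0 ≤ C ∧ ∀ (m a : ℝ), |m - M| + |a| ≤ 1 → ∀ (R : E3 →ₗᵢ[ℝ] E3) (v w : E3),
      ‖v‖ ≤ 1 → ‖w‖ ≤ 1 → ∀ i ≤ k, ∀ y : E3, ρ₁ < ‖y‖ → ‖y‖ < ρ₂ →
        ‖iteratedFDeriv ℝ i (fun z : E3 ↦ cylH m a r₀ τ₀ R z v w - gbarRep M r₀ z v w) y‖ ≤
          C * (|m - M| + |a|) := by
  -- the smooth family `F (p, y) = H₀[p, id](y) − H₀[(M, 0), id](y)` and the compact sets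
  set F : (ℝ × ℝ) × E3 → (E3 →L[ℝ] E3 →L[ℝ] ℝ) := fun q ↦
    cylH₀ q.1.1 q.1.2 r₀ τ₀ LinearIsometry.id q.2 - cylH₀ M 0 r₀ τ₀ LinearIsometry.id q.2 with hF_def
  have hU : IsOpen {q : (ℝ × ℝ) × E3 | q.2 ≠ 0} := isOpen_ne.preimage continuous_snd
  have hFs : ∀ q ∈ {q : (ℝ × ℝ) × E3 | q.2 ≠ 0}, ContDiffAt ℝ ∞ F q := by
    intro q hq
    have hq' : q.2 ≠ 0 := hq
    have h1 : ContDiffAt ℝ ∞ (fun q : (ℝ × ℝ) × E3 ↦ cylH₀ q.1.1 q.1.2 r₀ τ₀ LinearIsometry.id q.2) q := by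
      have h := (contDiffOn_cylH₀₃ hr₀ τ₀ LinearIsometry.id).contDiffAt
        ((isOpen_ne.preimage (continuous_snd.comp continuous_snd)).mem_nhds
          (show (q.1.1, q.1.2, q.2).2.2 ≠ 0 from hq'))
      exact h.comp q ((contDiffAt_fst.comp q contDiffAt_fst).prodMk
        ((contDiffAt_snd.comp q contDiffAt_fst).prodMk contDiffAt_snd))
    have h2 : ContDiffAt ℝ ∞ (fun q : (ℝ × ℝ) × E3 ↦ cylH₀ M 0 r₀ τ₀ LinearIsometry.id q.2) q :=
      ((contDiffOn_cylH₀ M 0 r₀ τ₀ LinearIsometry.id hr₀).contDiffAt (isOpen_ne.mem_nhds hq')).comp q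
        contDiffAt_snd
    exact h1.sub h2
  have hK : IsCompact (closedBall ((M, 0) : ℝ × ℝ) 1) := isCompact_closedBall _ _
  have hKc : Convex ℝ (closedBall ((M, 0) : ℝ × ℝ) 1) := convex_closedBall _ _
  have hL : IsCompact {y : E3 | ρ₁ ≤ ‖y‖ ∧ ‖y‖ ≤ ρ₂} :=
    Metric.isCompact_of_isClosed_isBounded
      ((isClosed_le continuous_const continuous_norm).inter (isClosed_le continuous_norm continuous_const))
      (isBounded_closedBall.subset fun y hy ↦ mem_closedBall_zero_iff.2 hy.2)
  have hL0 : ∀ y ∈ {y : E3 | ρ₁ ≤ ‖y‖ ∧ ‖y‖ ≤ ρ₂}, y ≠ 0 := fun y hy h ↦ by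
    have h1 : ρ₁ ≤ ‖y‖ := hy.1
    rw [h, norm_zero] at h1
    linarith
  have hKL : closedBall ((M, 0) : ℝ × ℝ) 1 ×ˢ {y : E3 | ρ₁ ≤ ‖y‖ ∧ ‖y‖ ≤ ρ₂} ⊆
      {q : (ℝ × ℝ) × E3 | q.2 ≠ 0} := fun q hq ↦ hL0 q.2 hq.2
  have h0 : ∀ y ∈ {y : E3 | ρ₁ ≤ ‖y‖ ∧ ‖y‖ ≤ ρ₂},
      (fun z ↦ F (((M, 0) : ℝ × ℝ), z)) =ᶠ[𝓝 y] fun _ ↦ 0 :=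
    fun y _ ↦ Eventually.of_forall fun z ↦ sub_self _
  obtain ⟨C, hC0, hC⟩ :=
    Literature.Analysis.Calculus.exists_norm_iteratedFDeriv_le_parametric_of_eq_zero hU hFs hK hKc
      hL hKL (mem_closedBall_self zero_le_one) h0 k
  refine ⟨C, hC0, fun m a hma R v w hv hw i hi y hy₁ hy₂ ↦ ?_⟩
  have hy0 : y ≠ 0 := fun h ↦ by rw [h, norm_zero] at hy₁; linarith
  -- membership of the parameter and of the rotated point
  have hp : ((m, a) : ℝ × ℝ) ∈ closedBall ((M, 0) : ℝ × ℝ) 1 := by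
    rw [mem_closedBall, dist_eq_norm, Prod.norm_def]
    refine max_le ?_ ?_
    · show ‖m - M‖ ≤ 1
      rw [Real.norm_eq_abs]; linarith [abs_nonneg a]
    · show ‖a - 0‖ ≤ 1
      rw [sub_zero, Real.norm_eq_abs]; linarith [abs_nonneg (m - M)]
  have hRy : R y ∈ {y : E3 | ρ₁ ≤ ‖y‖ ∧ ‖y‖ ≤ ρ₂} := by
    refine ⟨?_, ?_⟩ <;> rw [LinearIsometry.norm_map] <;> linarith
  have hRy0 : R y ≠ 0 := isometry_apply_ne_zero R hy0
  -- the function near `y` is `evalBilin (Rv) (Rw) ∘ F (m, a) ∘ R`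
  have hev : ∀ᶠ z in 𝓝 y, 1 < ‖z‖ :=
    (isOpen_lt continuous_const continuous_norm).mem_nhds (lt_of_le_of_lt hρ₁ hy₁)
  have e1 : (fun z : E3 ↦ cylH m a r₀ τ₀ R z v w - gbarRep M r₀ z v w) =ᶠ[𝓝 y]
      ((fun z' : E3 ↦ evalBilin (R v) (R w) (F ((m, a), z'))) ∘ isometryEquiv R) := by
    filter_upwards [hev] with z hz
    have hz0 : z ≠ 0 := fun h ↦ by rw [h, norm_zero] at hz; linarith
    show cylH m a r₀ τ₀ R z v w - gbarRep M r₀ z v w =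
      evalBilin (R v) (R w) (F ((m, a), R z))
    rw [cylH_apply, cylCutoff_of_le_norm hz.le, one_mul, sub_self, zero_mul, add_zero,
      ← cylH₀_zero_spin M hr₀ τ₀ R hz0 v w, evalBilin_apply, hF_def]
    simp only [sub_apply]
    rw [cylH₀_isometry m a r₀ τ₀ R z v w, cylH₀_isometry M 0 r₀ τ₀ R z v w]
  rw [(e1.iteratedFDeriv ℝ i).eq_of_nhds,
    LinearIsometryEquiv.norm_iteratedFDeriv_comp_right (isometryEquiv R) _ y i, coe_isometryEquiv]
  -- `Dⁱ(L ∘ F_p) = L ∘ Dⁱ F_p` on the open set `{z ≠ 0}`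
  have hFp : ContDiffOn ℝ ∞ (fun z' : E3 ↦ F ((m, a), z')) {z : E3 | z ≠ 0} := fun z hz ↦ by
    have hg : ContDiffAt ℝ ∞ F (((m, a) : ℝ × ℝ), z) := hFs _ hz
    have hf : ContDiffAt ℝ ∞ (fun z' : E3 ↦ (((m, a) : ℝ × ℝ), z')) z :=
      contDiffAt_const.prodMk contDiffAt_id
    exact (hg.comp z hf).contDiffWithinAt
  have hcomp : iteratedFDeriv ℝ i (fun z' : E3 ↦ evalBilin (R v) (R w) (F ((m, a), z'))) (R y) =
      (evalBilin (R v) (R w)).compContinuousMultilinearMap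
        (iteratedFDeriv ℝ i (fun z' : E3 ↦ F ((m, a), z')) (R y)) := by
    rw [← iteratedFDerivWithin_of_isOpen i isOpen_ne hRy0,
      ← iteratedFDerivWithin_of_isOpen i isOpen_ne hRy0]
    exact (evalBilin (R v) (R w)).iteratedFDerivWithin_comp_left (hFp (R y) hRy0)
      isOpen_ne.uniqueDiffOn hRy0 (by exact_mod_cast le_top)
  rw [hcomp]
  have hmain := hC i hi (m, a) hp (R y) hRy
  have hnorm : ‖((m, a) : ℝ × ℝ) - (M, 0)‖ ≤ |m - M| + |a| := by
    rw [Prod.norm_def]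
    refine max_le ?_ ?_
    · show ‖m - M‖ ≤ _
      rw [Real.norm_eq_abs]; linarith [abs_nonneg a]
    · show ‖a - 0‖ ≤ _
      rw [sub_zero, Real.norm_eq_abs]; linarith [abs_nonneg (m - M)]
  have hL1 : ‖evalBilin (R v) (R w)‖ ≤ 1 := by
    refine (norm_evalBilin_le _ _).trans ?_
    rw [LinearIsometry.norm_map, LinearIsometry.norm_map]
    nlinarith [norm_nonneg v, norm_nonneg w]
  calc ‖(evalBilin (R v) (R w)).compContinuousMultilinearMap
          (iteratedFDeriv ℝ i (fun z' : E3 ↦ F ((m, a), z')) (R y))‖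
      ≤ ‖evalBilin (R v) (R w)‖ * ‖iteratedFDeriv ℝ i (fun z' : E3 ↦ F ((m, a), z')) (R y)‖ :=
        ContinuousLinearMap.norm_compContinuousMultilinearMap_le _ _
    _ ≤ 1 * (C * ‖((m, a) : ℝ × ℝ) - (M, 0)‖) :=
        mul_le_mul hL1 hmain (norm_nonneg _) zero_le_one
    _ ≤ C * (|m - M| + |a|) := by
        rw [one_mul]; exact mul_le_mul_of_nonneg_left hnorm hC0

/-- **The metric of the Kerr-cylinder datum is `C(|m − M| + |a|)`-close in `C^k` on the annulus
to the Schwarzschild(`M`) cylinder metric** — the `h`-half of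
`NearSchwarzschildCylinder M r₁ r₀ ρ₁ ρ₂ k (C(|m − M| + |a|)) (kerrCylinderDatum …)` in the closed
form `nearSchwarzschildCylinder_iff`, with `C` independent of the admissible `(m, a)` in the unit
box and of the rotation `R`. [cite: LiMei2020, proof of Prop. 4.1, p. 22] -/
theorem exists_norm_iteratedFDeriv_kerrCylinderDatum_h_sub_le [Kerr.Facts] (M : ℝ) {r₀ : ℝ}
    (hr₀ : 0 < r₀) {ρ₁ : ℝ} (hρ₁ : 1 ≤ ρ₁) (ρ₂ τ₀ : ℝ) (k : ℕ) :
    ∃ C : ℝ, 0 ≤ C ∧ ∀ (m a : ℝ) (ha : |a| < m) (h₁ : Kerr.rMinus m a < r₀)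
      (h₂ : r₀ < Kerr.rPlus m a), |m - M| + |a| ≤ 1 → ∀ (R : E3 →ₗᵢ[ℝ] E3) (v w : E3),
      ‖v‖ ≤ 1 → ‖w‖ ≤ 1 → ∀ i ≤ k, ∀ y : E3, ρ₁ < ‖y‖ → ‖y‖ < ρ₂ →
        ‖iteratedFDeriv ℝ i (fun z : E3 ↦ (kerrCylinderDatum ha h₁ h₂ τ₀ R).h.inner z v w -
          gbarRep M r₀ z v w) y‖ ≤ C * (|m - M| + |a|) := by
  obtain ⟨C, hC0, hC⟩ := exists_norm_iteratedFDeriv_cylH_sub_gbarRep_le M hr₀ hρ₁ ρ₂ τ₀ k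
  exact ⟨C, hC0, fun m a ha h₁ h₂ hma R v w hv hw i hi y hy₁ hy₂ ↦
    hC m a hma R v w hv hw i hi y hy₁ hy₂⟩

end LiMei

end Literature.Geometry.Lorentzian

end
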